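import Mathlib.Analysis.Real.Pi.Bounds
import Summits.Ventures.QEDPrecision.Statement

/-!
# Sanity lemmas for the enclosure schema `Encloses` (pub-qed REVIEW-RUNBOOK, card `Encloses`)

Review evidence only (ops-runbook sanity registry `registry/pub-qed.json`); no new definitions.
`Encloses x q w := |x − q| ≤ w` (`Summits/Ventures/QEDPrecision/Statement.lean`).

* (a) agreement with Mathlib: `Encloses x q w ↔ x ∈ Metric.closedBall (q : ℝ) w ↔ x ∈ [q − w, q + w]`;
* (b) holds: `1/3` is enclosed by `333/1000 ± 10⁻³`; `π` is enclosed by `22/7 ± 1/700` (Mathlib's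
  certified decimals of `π`); zero width means equality;
* (b) fails: `1` is not enclosed by `0 ± 1/2`; `π` is NOT enclosed by `22/7 ± 10⁻³` — the predicate is
  neither trivially true nor trivially false, and it is monotone in the width.
-/

namespace Summit.Ventures.QEDPrecision.Runbook

open Summit.Ventures.QEDPrecision

/-! ## (a) agreement with Mathlib's metric vocabulary -/

/-- `Encloses x q w` is membership of `x` in Mathlib's closed ball of radius `w` about `q`. -/
theorem encloses_iff_mem_closedBall (x : ℝ) (q w : ℚ) :
    Encloses x q w ↔ x ∈ Metric.closedBall (q : ℝ) (w : ℝ) := by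
  rw [Metric.mem_closedBall, Real.dist_eq, Encloses]

/-- `Encloses x q w` is membership of `x` in the closed interval `[q − w, q + w]`. -/
theorem encloses_iff_mem_Icc (x : ℝ) (q w : ℚ) :
    Encloses x q w ↔ x ∈ Set.Icc ((q : ℝ) - w) ((q : ℝ) + w) := by
  rw [encloses_iff_mem_closedBall, Real.closedBall_eq_Icc]

/-- Zero width is exactness: `Encloses x q 0 ↔ x = q`. -/
theorem encloses_zero_iff (x : ℝ) (q : ℚ) : Encloses x q 0 ↔ x = q := by
  rw [Encloses, Rat.cast_zero, abs_nonpos_iff, sub_eq_zero]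

/-- Monotonicity in the width. -/
theorem Encloses.mono {x : ℝ} {q w w' : ℚ} (h : Encloses x q w) (hw : w ≤ w') : Encloses x q w' :=
  le_trans h (by exact_mod_cast hw)

/-- An enclosure with negative width is impossible. -/
theorem Encloses.width_nonneg {x : ℝ} {q w : ℚ} (h : Encloses x q w) : 0 ≤ w := by
  have : (0 : ℝ) ≤ w := le_trans (abs_nonneg _) h
  exact_mod_cast this

/-! ## (b) holds- and fails-instances -/

/-- Holds-instance: `1/3 ∈ 0.333 ± 10⁻³` (`|1/3 − 333/1000| = 1/3000`). -/
theorem encloses_third : Encloses (1 / 3 : ℝ) (333 / 1000) (1 / 1000) := by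
  rw [Encloses, abs_le]
  constructor <;> push_cast <;> norm_num

/-- Holds-instance with a transcendental: `π ∈ 22/7 ± 1/700` (from Mathlib's `3.141592 < π < 3.141593`). -/
theorem encloses_pi_22_7 : Encloses Real.pi (22 / 7) (1 / 700) := by
  rw [Encloses, abs_le]
  have h1 := Real.pi_gt_d6
  have h2 := Real.pi_lt_d6
  constructor <;> push_cast <;> linarith

/-- Fails-instance: `1 ∉ 0 ± 1/2`. -/
theorem not_encloses_one_zero_half : ¬ Encloses 1 0 (1 / 2) := by
  rw [Encloses, abs_le]
  push_cast
  norm_num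

/-- Fails-instance with a transcendental: `π ∉ 22/7 ± 10⁻³` (`22/7 − π > 0.00126`). -/
theorem not_encloses_pi_22_7_milli : ¬ Encloses Real.pi (22 / 7) (1 / 1000) := by
  rw [Encloses, abs_le]
  push_cast
  have h2 := Real.pi_lt_d6
  intro h
  linarith [h.1]

end Summit.Ventures.QEDPrecision.Runbook
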